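/-
Copyright (c) 2026 the pub-hodgecm-mathlib formalisation cell (harness21).  Prover seat hodgecm-mathlib-R90-C133-p02 (g2), Track B ∕ R90-TF, h413 = `stmt-HodgeConjecture-24833`,
R90-TF section S8 «ContSpec-n½» ((ADM) road of the (R)′ letter `hDISC`; my 01:1xZ line (iii) «`hχu` census»): the character-unitarity letter `hχu` of ★ p864054 ∕ ★ p864216 is
DISCHARGED — automorphic characters of the anisotropic torus `U(1)_{L∕L⁺}(𝔸)` are unitary (★ `norm_torusHom_apply_eq_one_of_isAutomorphic`, [Godement1964 §5 Thm. 4]) — so the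
Godement letter `hSUM` HOLDS and `hDISC` = ★ ∘ {(INV), (W1)} (equivalently {(INV), (W1′)}): TWO letters, both the analytic density∕invariance of the `K`-finite residue span.
-/
import Summits.HodgeConjecture.HodgeConjecture.Theorems.R90S8ResGMidAtomAdmissibleOfKFiniteU3    -- ★ p864216: `hADM_of_kFinite`, `hDISC_of_inv_of_kFinite`; brings ★ p864054 `hSUM_of_unitary`, `hADM_of_unitary_of_W1`, `hDISC_of_inv_of_unitary_of_W1`, ★ p863995, ★ p863816
import Literature.NumberTheory.Automorphic.UnitaryGroupAdelicOneTorusDictionary                 -- ★ `UnitaryGroup.norm_torusHom_apply_eq_one_of_isAutomorphic` (automorphic torus characters are unitary)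
import HarnessLib

/-!
# S8 (R)′ road — `R90S8ResGMidAtomAdmissibleOfDensityU3`: THE UNITARITY LETTER DISCHARGED; `hSUM` HOLDS; `hDISC` = ★ ∘ {(INV), (W1)}

Track B ∕ R90-TF, crux h413 = `stmt-HodgeConjecture-24833`, route of record `HCCMUnconditional`; cell `hodgecm-mathlib`, R90-TF section S8 «ContSpec-n½ ∕ ResidualSpectrum», socket (R)
(B ED. 7 :337) ← ★ `res_midBlock_le_residual_of_letters' (hDISC) …` ← ★ p863816 `hDISC_of_inv_of_admissible (hINV) (hADM)` ← ★ p864216 ∕ ★ p864054 (`hADM` over {`hχu`, density}).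
THEOREMS ONLY (no `def`, no `instance`, no `notation`, no named-fact hypothesis, no `sorry`; default heartbeats); lane `--supports stmt-HodgeConjecture-24833 --as helper` (count-neutral).
CLOSES NO SOCKET.  THE POINT: `ξ.η` and `ξ.ψ` are AUTOMORPHIC continuous characters of `T(𝔸_{L⁺})`, `T = U(1)_{L∕L⁺}` (★ `OneDimAutRepH.hη ∕ .hψ`), hence UNITARY (★
`norm_torusHom_apply_eq_one_of_isAutomorphic`: a continuous character of the norm-one idèles trivial on the principal ones has compact image — Godement); so the letter `hχu` of ★ p864054
∕ ★ p864216 holds outright, the Godement summability `hSUM` of ★ p863995 holds outright (`μω` unitary is the frame's binder), and the (R)′ row `hDISC` is ★ modulo EXACTLY the two density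
∕ invariance letters: (INV) «the level-free atom (closed span of all typed middle-pole residues) is `R(G(𝔸))`-stable» and (W1) «residue classes of `K_max`-FINITE sections are total in
it» (or its consequence (W1′), ★ β2 p864185) — both L, both about the `K`-finite Eisenstein theory [MW95 I.2.17–18, V.3.13], (W1) unprinted as typed at exotic generators (J-S8-W1).
* `norm_eta_apply_eq_one`, `norm_psi_apply_eq_one`, **`oneDimAutRepH_chars_unitary`** (the `hχu` letter, PROVED).
* **`hSUM_holds`** (the `hSUM` binder of ★ p863995, ∀-closed, PROVED), **`hADM_of_W1prime`**, **`hADM_of_W1`**, **`hDISC_of_inv_of_W1prime`**, **`hDISC_of_inv_of_W1`** (the `hDISC` bytes from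
  {(INV), (W1′)} resp. {(INV), (W1)}).
HONEST LABEL: HC_CM is proved only modulo the 7 printed citations (2 remaining named inputs: hLiu418 = `stmt-HodgeConjecture-24832`, h413 = `stmt-HodgeConjecture-24833`) until
rung 0 closes; REL ≠ ★ ≠ BUILT; `hDISC` = ★ ∘ {(INV), (W1)}, both OPEN and L; pays no socket; count-neutral.

## References
* [Godement1964] R. Godement, *Domaines fondamentaux des groupes arithmétiques*, Sém. Bourbaki 257 (1964), §5 Thm. 4, §8.
* [MoeglinWaldspurger1995] C. Mœglin, J.-L. Waldspurger, *Spectral Decomposition and Eisenstein Series* (1995), I.2.17–I.2.18, V.3.13.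
* [Rogawski1990] J. D. Rogawski, *Automorphic Representations of Unitary Groups in Three Variables* (1990), §12.2 p. 174, §13.9 p. 229 (ii).
-/

set_option autoImplicit false
set_option linter.dupNamespace false  -- the mandated namespace `…HodgeConjecture.HodgeConjecture.R90.S8` (LEAD #1 L1) repeats the summit's segment

noncomputable section

open MeasureTheory Measure Set Filter Topology NumberField ContRepresentation
open Literature.NumberTheory Literature.NumberTheory.Automorphic Literature.NumberTheory.Automorphic.UnitaryGroup Literature.NumberTheory.GaloisRepresentations AdelicGroupData
open Literature.NumberTheory.Automorphic.Arthur2013.Leaves.TECR Literature.NumberTheory.Rogawski1990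
open Summit.HodgeConjecture.HodgeConjecture.Cruxes.H413.K2E1BorelEisensteinU
open Summit.HodgeConjecture.HodgeConjecture.Cruxes.H413.K2E1CharacterEisensteinU3PairDefs
open Summit.HodgeConjecture.HodgeConjecture.Cruxes.H413.K2E1ChiSectionSpaceU3PairDefs
open scoped ENNReal NNReal

namespace Summit.HodgeConjecture.HodgeConjecture.R90.S8

/-! ## §1 The characters of a one-dimensional automorphic `ξ` of `H` are unitary -/

section Unitary

variable (L : Type) [Field L] [NumberField L] [IsCMField L] (ξ : OneDimAutRepH L)

/-- **`‖ξ.η t‖ = 1`** — `ξ.η` is an automorphic continuous character of `T(𝔸_{L⁺})` (★ `ξ.hη`), hence unitary (★ `norm_torusHom_apply_eq_one_of_isAutomorphic`; `[L : L⁺] = 2` and `c ≠ 1` by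
Mathlib). [cite: Godement1964, §5 Thm. 4] [cite: Rogawski1990, §12.2 p. 174] -/
theorem norm_eta_apply_eq_one (t : ↥(TorusDict.torus (IsCMField.complexConj L))) : ‖((ξ.η t : ℂˣ) : ℂ)‖ = 1 :=
  norm_torusHom_apply_eq_one_of_isAutomorphic _ L _ (Algebra.IsQuadraticExtension.finrank_eq_two _ L) (IsCMField.complexConj_ne_one (K := L)) ξ.η ξ.hη t

/-- **`‖ξ.ψ t‖ = 1`** — the same for `ξ.ψ` (★ `ξ.hψ`). [cite: Godement1964, §5 Thm. 4] [cite: Rogawski1990, §12.2 p. 174] -/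
theorem norm_psi_apply_eq_one (t : ↥(TorusDict.torus (IsCMField.complexConj L))) : ‖((ξ.ψ t : ℂˣ) : ℂ)‖ = 1 :=
  norm_torusHom_apply_eq_one_of_isAutomorphic _ L _ (Algebra.IsQuadraticExtension.finrank_eq_two _ L) (IsCMField.complexConj_ne_one (K := L)) ξ.ψ ξ.hψ t

end Unitary

/-- **THE LETTER `hχu` OF ★ p864054 ∕ ★ p864216, PROVED** (∀-closed over `(L, ξ)`). [cite: Godement1964, §5 Thm. 4] -/
theorem oneDimAutRepH_chars_unitary :
    ∀ (L : Type) [Field L] [NumberField L] [IsCMField L] (ξ : OneDimAutRepH L),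
      (∀ t, ‖((ξ.η t : ℂˣ) : ℂ)‖ = 1) ∧ ∀ t, ‖((ξ.ψ t : ℂˣ) : ℂ)‖ = 1 :=
  fun L _ _ _ ξ => ⟨norm_eta_apply_eq_one L ξ, norm_psi_apply_eq_one L ξ⟩

/-! ## §2 `hSUM` holds; `hADM` and `hDISC` over the density ∕ invariance letters alone -/

section Corollaries

/-- **THE GODEMENT LETTER `hSUM` OF ★ p863995 HOLDS** (∀-closed in the `hADM` frame; `μω` unitary is the frame's own binder): ★ `hSUM_of_unitary` + §1. [cite: Godement1964, §8]
[cite: MoeglinWaldspurger1995, II.1.5] -/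
theorem hSUM_holds :
    ∀ (L : Type) [Field L] [NumberField L] [IsCMField L]
      (μ : Measure (quasiSplit (↥(maximalRealSubfield L)) L (IsCMField.complexConj L) 3).automorphicQuotient) [(quasiSplit (↥(maximalRealSubfield L)) L (IsCMField.complexConj L) 3).IsAutomorphicMeasure μ]
      (μω : HeckeCharacter L) (_ : μω.IsUnitary) (ξ : OneDimAutRepH L), ∀ φ ∈ chiSectionSpacePair (ξ.bcη⁻¹ * ξ.bcψ⁻¹ * μω) ξ.ψ (⊥ : Subgroup (quasiSplit (↥(maximalRealSubfield L)) L (IsCMField.complexConj L) 3).Adelic)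
          ((1 : ↥(⊥ : Subgroup (quasiSplit (↥(maximalRealSubfield L)) L (IsCMField.complexConj L) 3).Adelic) →* ℂ) : ↥(⊥ : Subgroup (quasiSplit (↥(maximalRealSubfield L)) L (IsCMField.complexConj L) 3).Adelic) → ℂ),
      Continuous φ → ∀ z : ℂ, 2 < z.re → ∀ g : (quasiSplit (↥(maximalRealSubfield L)) L (IsCMField.complexConj L) 3).Adelic,
      Summable fun q : Quotient (MulAction.orbitRel ↥(borelU ((IsCMField.complexConj L : L ≃ₐ[↥(maximalRealSubfield L)] L) : L →+* L) ((StdForm.antidiagonal 3).over L)) ↥(unitaryGroupOfForm ((IsCMField.complexConj L : L ≃ₐ[↥(maximalRealSubfield L)] L) : L →+* L) ((StdForm.antidiagonal 3).over L))) =>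
        ‖flatSectionU φ z ((quasiSplit (↥(maximalRealSubfield L)) L (IsCMField.complexConj L) 3).toAdelic (Quotient.out q : ↥(unitaryGroupOfForm ((IsCMField.complexConj L : L ≃ₐ[↥(maximalRealSubfield L)] L) : L →+* L) ((StdForm.antidiagonal 3).over L))) * g)‖ :=
  fun L _ _ _ _ _ μω hμu ξ => hSUM_of_unitary L ξ μω hμu (norm_eta_apply_eq_one L ξ) (norm_psi_apply_eq_one L ξ)

/-- **`hADM` OF ★ p863816 FROM (W1′) ALONE** (irreducible-span density; ★ `hADM_of_unitary_of_W1` + §1). [cite: WallachRRG1, §3.3.1] [cite: MoeglinWaldspurger1995, I.2.17, V.3.13] -/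
theorem hADM_of_W1prime
    (hW1 : ∀ (L : Type) [Field L] [NumberField L] [IsCMField L]
      (μ : Measure (quasiSplit (↥(maximalRealSubfield L)) L (IsCMField.complexConj L) 3).automorphicQuotient) [(quasiSplit (↥(maximalRealSubfield L)) L (IsCMField.complexConj L) 3).IsAutomorphicMeasure μ]
      (μω : HeckeCharacter L) (_ : μω.IsUnitary) (ξ : OneDimAutRepH L), resGMidAtom L μ ξ μω ⊥ 1 ≤ (Submodule.span ℂ {f : (quasiSplit (↥(maximalRealSubfield L)) L (IsCMField.complexConj L) 3).L2 μ | ∃ φ : (quasiSplit (↥(maximalRealSubfield L)) L (IsCMField.complexConj L) 3).Adelic → ℂ, (φ ∈ chiSectionSpacePair (ξ.bcη⁻¹ * ξ.bcψ⁻¹ * μω) ξ.ψ (⊥ : Subgroup (quasiSplit (↥(maximalRealSubfield L)) L (IsCMField.complexConj L) 3).Adelic)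
          ((1 : ↥(⊥ : Subgroup (quasiSplit (↥(maximalRealSubfield L)) L (IsCMField.complexConj L) 3).Adelic) →* ℂ) : ↥(⊥ : Subgroup (quasiSplit (↥(maximalRealSubfield L)) L (IsCMField.complexConj L) 3).Adelic) → ℂ) ∧ Continuous φ ∧
          ∃ (Ec : ℂ → (quasiSplit (↥(maximalRealSubfield L)) L (IsCMField.complexConj L) 3).Adelic → ℂ) (Sp : Finset ℂ)
            (_ : ∀ s ∈ Sp, s.im = 0 ∧ 1 < s.re ∧ s.re ≤ 2)
            (_ : ∀ g, DifferentiableOn ℂ (fun z => Ec z g) ({z : ℂ | 1 < z.re} \ (↑Sp : Set ℂ)))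
            (_ : ∀ z : ℂ, 2 < z.re → Ec z = eisensteinSeriesU (flatSectionU φ z))
            (Fp : (quasiSplit (↥(maximalRealSubfield L)) L (IsCMField.complexConj L) 3).Adelic → ℂ → ℂ)
            (_ : ∀ g, AnalyticAt ℂ (Fp g) ((3 : ℂ) / 2))
            (_ : ∀ g, Fp g =ᶠ[𝓝[≠] ((3 : ℂ) / 2)] fun z => (z - (3 : ℂ) / 2) * Ec z g),
            (f : (quasiSplit (↥(maximalRealSubfield L)) L (IsCMField.complexConj L) 3).automorphicQuotient → ℂ) =ᵐ[μ] (fun x : (quasiSplit (↥(maximalRealSubfield L)) L (IsCMField.complexConj L) 3).automorphicQuotient => Fp (Quotient.out (x : ((quasiSplit (↥(maximalRealSubfield L)) L (IsCMField.complexConj L) 3).Adelic ⧸ (quasiSplit (↥(maximalRealSubfield L)) L (IsCMField.complexConj L) 3).quotientSubgroup)))⁻¹ ((3 : ℂ) / 2))) ∧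
          ∃ (S : Submodule ℂ ((quasiSplit (↥(maximalRealSubfield L)) L (IsCMField.complexConj L) 3).Adelic → ℂ)) (hS : ∀ k : ↥((standardMaximalCompactGL 3 L).comap (adelicVal (↥(maximalRealSubfield L)) L (IsCMField.complexConj L) 3 ((StdForm.antidiagonal 3).over L)) :
      Subgroup (quasiSplit (↥(maximalRealSubfield L)) L (IsCMField.complexConj L) 3).Adelic), ∀ ψ ∈ S, ((rightTranslation (quasiSplit (↥(maximalRealSubfield L)) L (IsCMField.complexConj L) 3)).comp ((standardMaximalCompactGL 3 L).comap (adelicVal (↥(maximalRealSubfield L)) L (IsCMField.complexConj L) 3 ((StdForm.antidiagonal 3).over L)) :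
      Subgroup (quasiSplit (↥(maximalRealSubfield L)) L (IsCMField.complexConj L) 3).Adelic).subtype) k ψ ∈ S),
            φ ∈ S ∧ FiniteDimensional ℂ ↥S ∧ (Subrepresentation.toRepresentation (⟨S, hS⟩ : Subrepresentation ((rightTranslation (quasiSplit (↥(maximalRealSubfield L)) L (IsCMField.complexConj L) 3)).comp ((standardMaximalCompactGL 3 L).comap (adelicVal (↥(maximalRealSubfield L)) L (IsCMField.complexConj L) 3 ((StdForm.antidiagonal 3).over L)) :
      Subgroup (quasiSplit (↥(maximalRealSubfield L)) L (IsCMField.complexConj L) 3).Adelic).subtype))).IsIrreducible}).topologicalClosure) :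
    ∀ (L : Type) [Field L] [NumberField L] [IsCMField L]
      (μ : Measure (quasiSplit (↥(maximalRealSubfield L)) L (IsCMField.complexConj L) 3).automorphicQuotient) [(quasiSplit (↥(maximalRealSubfield L)) L (IsCMField.complexConj L) 3).IsAutomorphicMeasure μ]
      (μω : HeckeCharacter L) (_ : μω.IsUnitary) (ξ : OneDimAutRepH L)
      (hA : ∀ (k : ↥((standardMaximalCompactGL 3 L).comap (adelicVal (↥(maximalRealSubfield L)) L (IsCMField.complexConj L) 3 ((StdForm.antidiagonal 3).over L)) :
        Subgroup (quasiSplit (↥(maximalRealSubfield L)) L (IsCMField.complexConj L) 3).Adelic)), ∀ x ∈ resGMidAtom L μ ξ μω ⊥ 1,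
          (((quasiSplit (↥(maximalRealSubfield L)) L (IsCMField.complexConj L) 3).rightRegular μ).restrict
            (((standardMaximalCompactGL 3 L).comap (adelicVal (↥(maximalRealSubfield L)) L (IsCMField.complexConj L) 3 ((StdForm.antidiagonal 3).over L)) :
              Subgroup (quasiSplit (↥(maximalRealSubfield L)) L (IsCMField.complexConj L) 3).Adelic)).subtype) k x ∈ resGMidAtom L μ ξ μω ⊥ 1)
      (E : Submodule ℂ ((quasiSplit (↥(maximalRealSubfield L)) L (IsCMField.complexConj L) 3).L2 μ)) (_ : E ≤ resGMidAtom L μ ξ μω ⊥ 1)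
      (hE : ∀ k, ∀ x ∈ E, (((quasiSplit (↥(maximalRealSubfield L)) L (IsCMField.complexConj L) 3).rightRegular μ).restrict
            (((standardMaximalCompactGL 3 L).comap (adelicVal (↥(maximalRealSubfield L)) L (IsCMField.complexConj L) 3 ((StdForm.antidiagonal 3).over L)) :
              Subgroup (quasiSplit (↥(maximalRealSubfield L)) L (IsCMField.complexConj L) 3).Adelic)).subtype) k x ∈ E), FiniteDimensional ℂ E →
      ((((quasiSplit (↥(maximalRealSubfield L)) L (IsCMField.complexConj L) 3).rightRegular μ).restrict
            (((standardMaximalCompactGL 3 L).comap (adelicVal (↥(maximalRealSubfield L)) L (IsCMField.complexConj L) 3 ((StdForm.antidiagonal 3).over L)) :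
              Subgroup (quasiSplit (↥(maximalRealSubfield L)) L (IsCMField.complexConj L) 3).Adelic)).subtype).subRep E hE).IsIrreducible →
      FiniteDimensional ℂ ↥(Representation.homRangeSum
        ((((quasiSplit (↥(maximalRealSubfield L)) L (IsCMField.complexConj L) 3).rightRegular μ).restrict
            (((standardMaximalCompactGL 3 L).comap (adelicVal (↥(maximalRealSubfield L)) L (IsCMField.complexConj L) 3 ((StdForm.antidiagonal 3).over L)) :
              Subgroup (quasiSplit (↥(maximalRealSubfield L)) L (IsCMField.complexConj L) 3).Adelic)).subtype).subRep (resGMidAtom L μ ξ μω ⊥ 1) hA)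
        ((((quasiSplit (↥(maximalRealSubfield L)) L (IsCMField.complexConj L) 3).rightRegular μ).restrict
            (((standardMaximalCompactGL 3 L).comap (adelicVal (↥(maximalRealSubfield L)) L (IsCMField.complexConj L) 3 ((StdForm.antidiagonal 3).over L)) :
              Subgroup (quasiSplit (↥(maximalRealSubfield L)) L (IsCMField.complexConj L) 3).Adelic)).subtype).subRep E hE)) :=
  hADM_of_unitary_of_W1 oneDimAutRepH_chars_unitary hW1

/-- **`hADM` OF ★ p863816 FROM (W1) ALONE** (`K_max`-finite density; ★ `hADM_of_kFinite` + §1). [cite: WallachRRG1, §3.3.1] [cite: MoeglinWaldspurger1995, I.2.17, V.3.13] -/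
theorem hADM_of_W1
    (hW1 : ∀ (L : Type) [Field L] [NumberField L] [IsCMField L]
      (μ : Measure (quasiSplit (↥(maximalRealSubfield L)) L (IsCMField.complexConj L) 3).automorphicQuotient) [(quasiSplit (↥(maximalRealSubfield L)) L (IsCMField.complexConj L) 3).IsAutomorphicMeasure μ]
      (μω : HeckeCharacter L) (_ : μω.IsUnitary) (ξ : OneDimAutRepH L), resGMidAtom L μ ξ μω ⊥ 1 ≤ (Submodule.span ℂ {f : (quasiSplit (↥(maximalRealSubfield L)) L (IsCMField.complexConj L) 3).L2 μ | ∃ φ : (quasiSplit (↥(maximalRealSubfield L)) L (IsCMField.complexConj L) 3).Adelic → ℂ, (φ ∈ chiSectionSpacePair (ξ.bcη⁻¹ * ξ.bcψ⁻¹ * μω) ξ.ψ (⊥ : Subgroup (quasiSplit (↥(maximalRealSubfield L)) L (IsCMField.complexConj L) 3).Adelic)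
          ((1 : ↥(⊥ : Subgroup (quasiSplit (↥(maximalRealSubfield L)) L (IsCMField.complexConj L) 3).Adelic) →* ℂ) : ↥(⊥ : Subgroup (quasiSplit (↥(maximalRealSubfield L)) L (IsCMField.complexConj L) 3).Adelic) → ℂ) ∧ Continuous φ ∧
          ∃ (Ec : ℂ → (quasiSplit (↥(maximalRealSubfield L)) L (IsCMField.complexConj L) 3).Adelic → ℂ) (Sp : Finset ℂ)
            (_ : ∀ s ∈ Sp, s.im = 0 ∧ 1 < s.re ∧ s.re ≤ 2)
            (_ : ∀ g, DifferentiableOn ℂ (fun z => Ec z g) ({z : ℂ | 1 < z.re} \ (↑Sp : Set ℂ)))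
            (_ : ∀ z : ℂ, 2 < z.re → Ec z = eisensteinSeriesU (flatSectionU φ z))
            (Fp : (quasiSplit (↥(maximalRealSubfield L)) L (IsCMField.complexConj L) 3).Adelic → ℂ → ℂ)
            (_ : ∀ g, AnalyticAt ℂ (Fp g) ((3 : ℂ) / 2))
            (_ : ∀ g, Fp g =ᶠ[𝓝[≠] ((3 : ℂ) / 2)] fun z => (z - (3 : ℂ) / 2) * Ec z g),
            (f : (quasiSplit (↥(maximalRealSubfield L)) L (IsCMField.complexConj L) 3).automorphicQuotient → ℂ) =ᵐ[μ] (fun x : (quasiSplit (↥(maximalRealSubfield L)) L (IsCMField.complexConj L) 3).automorphicQuotient => Fp (Quotient.out (x : ((quasiSplit (↥(maximalRealSubfield L)) L (IsCMField.complexConj L) 3).Adelic ⧸ (quasiSplit (↥(maximalRealSubfield L)) L (IsCMField.complexConj L) 3).quotientSubgroup)))⁻¹ ((3 : ℂ) / 2))) ∧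
          FiniteDimensional ℂ ↥(Submodule.span ℂ (Set.range fun k : ↥((standardMaximalCompactGL 3 L).comap (adelicVal (↥(maximalRealSubfield L)) L (IsCMField.complexConj L) 3 ((StdForm.antidiagonal 3).over L)) :
      Subgroup (quasiSplit (↥(maximalRealSubfield L)) L (IsCMField.complexConj L) 3).Adelic) => ((rightTranslation (quasiSplit (↥(maximalRealSubfield L)) L (IsCMField.complexConj L) 3)).comp ((standardMaximalCompactGL 3 L).comap (adelicVal (↥(maximalRealSubfield L)) L (IsCMField.complexConj L) 3 ((StdForm.antidiagonal 3).over L)) :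
      Subgroup (quasiSplit (↥(maximalRealSubfield L)) L (IsCMField.complexConj L) 3).Adelic).subtype) k φ))}).topologicalClosure) :
    ∀ (L : Type) [Field L] [NumberField L] [IsCMField L]
      (μ : Measure (quasiSplit (↥(maximalRealSubfield L)) L (IsCMField.complexConj L) 3).automorphicQuotient) [(quasiSplit (↥(maximalRealSubfield L)) L (IsCMField.complexConj L) 3).IsAutomorphicMeasure μ]
      (μω : HeckeCharacter L) (_ : μω.IsUnitary) (ξ : OneDimAutRepH L)
      (hA : ∀ (k : ↥((standardMaximalCompactGL 3 L).comap (adelicVal (↥(maximalRealSubfield L)) L (IsCMField.complexConj L) 3 ((StdForm.antidiagonal 3).over L)) :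
        Subgroup (quasiSplit (↥(maximalRealSubfield L)) L (IsCMField.complexConj L) 3).Adelic)), ∀ x ∈ resGMidAtom L μ ξ μω ⊥ 1,
          (((quasiSplit (↥(maximalRealSubfield L)) L (IsCMField.complexConj L) 3).rightRegular μ).restrict
            (((standardMaximalCompactGL 3 L).comap (adelicVal (↥(maximalRealSubfield L)) L (IsCMField.complexConj L) 3 ((StdForm.antidiagonal 3).over L)) :
              Subgroup (quasiSplit (↥(maximalRealSubfield L)) L (IsCMField.complexConj L) 3).Adelic)).subtype) k x ∈ resGMidAtom L μ ξ μω ⊥ 1)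
      (E : Submodule ℂ ((quasiSplit (↥(maximalRealSubfield L)) L (IsCMField.complexConj L) 3).L2 μ)) (_ : E ≤ resGMidAtom L μ ξ μω ⊥ 1)
      (hE : ∀ k, ∀ x ∈ E, (((quasiSplit (↥(maximalRealSubfield L)) L (IsCMField.complexConj L) 3).rightRegular μ).restrict
            (((standardMaximalCompactGL 3 L).comap (adelicVal (↥(maximalRealSubfield L)) L (IsCMField.complexConj L) 3 ((StdForm.antidiagonal 3).over L)) :
              Subgroup (quasiSplit (↥(maximalRealSubfield L)) L (IsCMField.complexConj L) 3).Adelic)).subtype) k x ∈ E), FiniteDimensional ℂ E →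
      ((((quasiSplit (↥(maximalRealSubfield L)) L (IsCMField.complexConj L) 3).rightRegular μ).restrict
            (((standardMaximalCompactGL 3 L).comap (adelicVal (↥(maximalRealSubfield L)) L (IsCMField.complexConj L) 3 ((StdForm.antidiagonal 3).over L)) :
              Subgroup (quasiSplit (↥(maximalRealSubfield L)) L (IsCMField.complexConj L) 3).Adelic)).subtype).subRep E hE).IsIrreducible →
      FiniteDimensional ℂ ↥(Representation.homRangeSum
        ((((quasiSplit (↥(maximalRealSubfield L)) L (IsCMField.complexConj L) 3).rightRegular μ).restrict
            (((standardMaximalCompactGL 3 L).comap (adelicVal (↥(maximalRealSubfield L)) L (IsCMField.complexConj L) 3 ((StdForm.antidiagonal 3).over L)) :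
              Subgroup (quasiSplit (↥(maximalRealSubfield L)) L (IsCMField.complexConj L) 3).Adelic)).subtype).subRep (resGMidAtom L μ ξ μω ⊥ 1) hA)
        ((((quasiSplit (↥(maximalRealSubfield L)) L (IsCMField.complexConj L) 3).rightRegular μ).restrict
            (((standardMaximalCompactGL 3 L).comap (adelicVal (↥(maximalRealSubfield L)) L (IsCMField.complexConj L) 3 ((StdForm.antidiagonal 3).over L)) :
              Subgroup (quasiSplit (↥(maximalRealSubfield L)) L (IsCMField.complexConj L) 3).Adelic)).subtype).subRep E hE)) :=
  hADM_of_kFinite oneDimAutRepH_chars_unitary hW1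

/-- **`hDISC` OF (R)′ FROM {(INV), (W1′)}** — conclusion = the `hDISC` binder bytes of ★ p863422 ∕ p863518 VERBATIM. [cite: MoeglinWaldspurger1995, I.2.17–I.2.18, V.3.13] [cite: Rogawski1990, §13.9 p. 229 (ii)] -/
theorem hDISC_of_inv_of_W1prime
    (hINV : ∀ (L : Type) [Field L] [NumberField L] [IsCMField L]
      (μ : Measure (quasiSplit (↥(maximalRealSubfield L)) L (IsCMField.complexConj L) 3).automorphicQuotient) [(quasiSplit (↥(maximalRealSubfield L)) L (IsCMField.complexConj L) 3).IsAutomorphicMeasure μ]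
      (μω : HeckeCharacter L) (_ : μω.IsUnitary) (ξ : OneDimAutRepH L),
      ∀ g : (quasiSplit (↥(maximalRealSubfield L)) L (IsCMField.complexConj L) 3).Adelic, ∀ f ∈ resGMidAtom L μ ξ μω ⊥ 1,
        ((quasiSplit (↥(maximalRealSubfield L)) L (IsCMField.complexConj L) 3).rightRegular μ) g f ∈ resGMidAtom L μ ξ μω ⊥ 1)
    (hW1 : ∀ (L : Type) [Field L] [NumberField L] [IsCMField L]
      (μ : Measure (quasiSplit (↥(maximalRealSubfield L)) L (IsCMField.complexConj L) 3).automorphicQuotient) [(quasiSplit (↥(maximalRealSubfield L)) L (IsCMField.complexConj L) 3).IsAutomorphicMeasure μ]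
      (μω : HeckeCharacter L) (_ : μω.IsUnitary) (ξ : OneDimAutRepH L), resGMidAtom L μ ξ μω ⊥ 1 ≤ (Submodule.span ℂ {f : (quasiSplit (↥(maximalRealSubfield L)) L (IsCMField.complexConj L) 3).L2 μ | ∃ φ : (quasiSplit (↥(maximalRealSubfield L)) L (IsCMField.complexConj L) 3).Adelic → ℂ, (φ ∈ chiSectionSpacePair (ξ.bcη⁻¹ * ξ.bcψ⁻¹ * μω) ξ.ψ (⊥ : Subgroup (quasiSplit (↥(maximalRealSubfield L)) L (IsCMField.complexConj L) 3).Adelic)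
          ((1 : ↥(⊥ : Subgroup (quasiSplit (↥(maximalRealSubfield L)) L (IsCMField.complexConj L) 3).Adelic) →* ℂ) : ↥(⊥ : Subgroup (quasiSplit (↥(maximalRealSubfield L)) L (IsCMField.complexConj L) 3).Adelic) → ℂ) ∧ Continuous φ ∧
          ∃ (Ec : ℂ → (quasiSplit (↥(maximalRealSubfield L)) L (IsCMField.complexConj L) 3).Adelic → ℂ) (Sp : Finset ℂ)
            (_ : ∀ s ∈ Sp, s.im = 0 ∧ 1 < s.re ∧ s.re ≤ 2)
            (_ : ∀ g, DifferentiableOn ℂ (fun z => Ec z g) ({z : ℂ | 1 < z.re} \ (↑Sp : Set ℂ)))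
            (_ : ∀ z : ℂ, 2 < z.re → Ec z = eisensteinSeriesU (flatSectionU φ z))
            (Fp : (quasiSplit (↥(maximalRealSubfield L)) L (IsCMField.complexConj L) 3).Adelic → ℂ → ℂ)
            (_ : ∀ g, AnalyticAt ℂ (Fp g) ((3 : ℂ) / 2))
            (_ : ∀ g, Fp g =ᶠ[𝓝[≠] ((3 : ℂ) / 2)] fun z => (z - (3 : ℂ) / 2) * Ec z g),
            (f : (quasiSplit (↥(maximalRealSubfield L)) L (IsCMField.complexConj L) 3).automorphicQuotient → ℂ) =ᵐ[μ] (fun x : (quasiSplit (↥(maximalRealSubfield L)) L (IsCMField.complexConj L) 3).automorphicQuotient => Fp (Quotient.out (x : ((quasiSplit (↥(maximalRealSubfield L)) L (IsCMField.complexConj L) 3).Adelic ⧸ (quasiSplit (↥(maximalRealSubfield L)) L (IsCMField.complexConj L) 3).quotientSubgroup)))⁻¹ ((3 : ℂ) / 2))) ∧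
          ∃ (S : Submodule ℂ ((quasiSplit (↥(maximalRealSubfield L)) L (IsCMField.complexConj L) 3).Adelic → ℂ)) (hS : ∀ k : ↥((standardMaximalCompactGL 3 L).comap (adelicVal (↥(maximalRealSubfield L)) L (IsCMField.complexConj L) 3 ((StdForm.antidiagonal 3).over L)) :
      Subgroup (quasiSplit (↥(maximalRealSubfield L)) L (IsCMField.complexConj L) 3).Adelic), ∀ ψ ∈ S, ((rightTranslation (quasiSplit (↥(maximalRealSubfield L)) L (IsCMField.complexConj L) 3)).comp ((standardMaximalCompactGL 3 L).comap (adelicVal (↥(maximalRealSubfield L)) L (IsCMField.complexConj L) 3 ((StdForm.antidiagonal 3).over L)) :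
      Subgroup (quasiSplit (↥(maximalRealSubfield L)) L (IsCMField.complexConj L) 3).Adelic).subtype) k ψ ∈ S),
            φ ∈ S ∧ FiniteDimensional ℂ ↥S ∧ (Subrepresentation.toRepresentation (⟨S, hS⟩ : Subrepresentation ((rightTranslation (quasiSplit (↥(maximalRealSubfield L)) L (IsCMField.complexConj L) 3)).comp ((standardMaximalCompactGL 3 L).comap (adelicVal (↥(maximalRealSubfield L)) L (IsCMField.complexConj L) 3 ((StdForm.antidiagonal 3).over L)) :
      Subgroup (quasiSplit (↥(maximalRealSubfield L)) L (IsCMField.complexConj L) 3).Adelic).subtype))).IsIrreducible}).topologicalClosure) :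
    ∀ (L : Type) [Field L] [NumberField L] [IsCMField L]
      (μ : Measure (quasiSplit (↥(maximalRealSubfield L)) L (IsCMField.complexConj L) 3).automorphicQuotient) [(quasiSplit (↥(maximalRealSubfield L)) L (IsCMField.complexConj L) 3).IsAutomorphicMeasure μ]
      (μω : HeckeCharacter L) (_ : μω.IsUnitary) (ξ : OneDimAutRepH L), ∀ (E : Submodule ℂ (resGMidBlock L μ ξ μω).toSubmodule)
          (hE : ∀ k, ∀ x ∈ E, ((resGMidBlock L μ ξ μω).toContRep.restrict (((standardMaximalCompactGL 3 L).comap (adelicVal (↥(maximalRealSubfield L)) L (IsCMField.complexConj L) 3 ((StdForm.antidiagonal 3).over L)) : Subgroup (quasiSplit (↥(maximalRealSubfield L)) L (IsCMField.complexConj L) 3).Adelic)).subtype) k x ∈ E), FiniteDimensional ℂ E →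
          (((resGMidBlock L μ ξ μω).toContRep.restrict (((standardMaximalCompactGL 3 L).comap (adelicVal (↥(maximalRealSubfield L)) L (IsCMField.complexConj L) 3 ((StdForm.antidiagonal 3).over L)) : Subgroup (quasiSplit (↥(maximalRealSubfield L)) L (IsCMField.complexConj L) 3).Adelic)).subtype).subRep E hE).IsIrreducible →
          FiniteDimensional ℂ (Representation.homRangeSum ((resGMidBlock L μ ξ μω).toContRep.restrict (((standardMaximalCompactGL 3 L).comap (adelicVal (↥(maximalRealSubfield L)) L (IsCMField.complexConj L) 3 ((StdForm.antidiagonal 3).over L)) : Subgroup (quasiSplit (↥(maximalRealSubfield L)) L (IsCMField.complexConj L) 3).Adelic)).subtype).toRepresentation (((resGMidBlock L μ ξ μω).toContRep.restrict (((standardMaximalCompactGL 3 L).comap (adelicVal (↥(maximalRealSubfield L)) L (IsCMField.complexConj L) 3 ((StdForm.antidiagonal 3).over L)) : Subgroup (quasiSplit (↥(maximalRealSubfield L)) L (IsCMField.complexConj L) 3).Adelic)).subtype).subRep E hE)) :=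
  hDISC_of_inv_of_admissible hINV (hADM_of_W1prime hW1)

/-- **`hDISC` OF (R)′ FROM {(INV), (W1)}** — THE LEDGER OF RECORD for the (R)′ row `hDISC`: ★ modulo exactly the two letters (INV) «the closed span of the middle-pole residues is
`G(𝔸)`-stable» and (W1) «residue classes of `K_max`-finite sections are total in it»; conclusion = the `hDISC` binder bytes of ★ p863422 ∕ p863518 VERBATIM.
[cite: MoeglinWaldspurger1995, I.2.17–I.2.18, V.3.13] [cite: Rogawski1990, §13.9 p. 229 (ii)] -/
theorem hDISC_of_inv_of_W1
    (hINV : ∀ (L : Type) [Field L] [NumberField L] [IsCMField L]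
      (μ : Measure (quasiSplit (↥(maximalRealSubfield L)) L (IsCMField.complexConj L) 3).automorphicQuotient) [(quasiSplit (↥(maximalRealSubfield L)) L (IsCMField.complexConj L) 3).IsAutomorphicMeasure μ]
      (μω : HeckeCharacter L) (_ : μω.IsUnitary) (ξ : OneDimAutRepH L),
      ∀ g : (quasiSplit (↥(maximalRealSubfield L)) L (IsCMField.complexConj L) 3).Adelic, ∀ f ∈ resGMidAtom L μ ξ μω ⊥ 1,
        ((quasiSplit (↥(maximalRealSubfield L)) L (IsCMField.complexConj L) 3).rightRegular μ) g f ∈ resGMidAtom L μ ξ μω ⊥ 1)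
    (hW1 : ∀ (L : Type) [Field L] [NumberField L] [IsCMField L]
      (μ : Measure (quasiSplit (↥(maximalRealSubfield L)) L (IsCMField.complexConj L) 3).automorphicQuotient) [(quasiSplit (↥(maximalRealSubfield L)) L (IsCMField.complexConj L) 3).IsAutomorphicMeasure μ]
      (μω : HeckeCharacter L) (_ : μω.IsUnitary) (ξ : OneDimAutRepH L), resGMidAtom L μ ξ μω ⊥ 1 ≤ (Submodule.span ℂ {f : (quasiSplit (↥(maximalRealSubfield L)) L (IsCMField.complexConj L) 3).L2 μ | ∃ φ : (quasiSplit (↥(maximalRealSubfield L)) L (IsCMField.complexConj L) 3).Adelic → ℂ, (φ ∈ chiSectionSpacePair (ξ.bcη⁻¹ * ξ.bcψ⁻¹ * μω) ξ.ψ (⊥ : Subgroup (quasiSplit (↥(maximalRealSubfield L)) L (IsCMField.complexConj L) 3).Adelic)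
          ((1 : ↥(⊥ : Subgroup (quasiSplit (↥(maximalRealSubfield L)) L (IsCMField.complexConj L) 3).Adelic) →* ℂ) : ↥(⊥ : Subgroup (quasiSplit (↥(maximalRealSubfield L)) L (IsCMField.complexConj L) 3).Adelic) → ℂ) ∧ Continuous φ ∧
          ∃ (Ec : ℂ → (quasiSplit (↥(maximalRealSubfield L)) L (IsCMField.complexConj L) 3).Adelic → ℂ) (Sp : Finset ℂ)
            (_ : ∀ s ∈ Sp, s.im = 0 ∧ 1 < s.re ∧ s.re ≤ 2)
            (_ : ∀ g, DifferentiableOn ℂ (fun z => Ec z g) ({z : ℂ | 1 < z.re} \ (↑Sp : Set ℂ)))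
            (_ : ∀ z : ℂ, 2 < z.re → Ec z = eisensteinSeriesU (flatSectionU φ z))
            (Fp : (quasiSplit (↥(maximalRealSubfield L)) L (IsCMField.complexConj L) 3).Adelic → ℂ → ℂ)
            (_ : ∀ g, AnalyticAt ℂ (Fp g) ((3 : ℂ) / 2))
            (_ : ∀ g, Fp g =ᶠ[𝓝[≠] ((3 : ℂ) / 2)] fun z => (z - (3 : ℂ) / 2) * Ec z g),
            (f : (quasiSplit (↥(maximalRealSubfield L)) L (IsCMField.complexConj L) 3).automorphicQuotient → ℂ) =ᵐ[μ] (fun x : (quasiSplit (↥(maximalRealSubfield L)) L (IsCMField.complexConj L) 3).automorphicQuotient => Fp (Quotient.out (x : ((quasiSplit (↥(maximalRealSubfield L)) L (IsCMField.complexConj L) 3).Adelic ⧸ (quasiSplit (↥(maximalRealSubfield L)) L (IsCMField.complexConj L) 3).quotientSubgroup)))⁻¹ ((3 : ℂ) / 2))) ∧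
          FiniteDimensional ℂ ↥(Submodule.span ℂ (Set.range fun k : ↥((standardMaximalCompactGL 3 L).comap (adelicVal (↥(maximalRealSubfield L)) L (IsCMField.complexConj L) 3 ((StdForm.antidiagonal 3).over L)) :
      Subgroup (quasiSplit (↥(maximalRealSubfield L)) L (IsCMField.complexConj L) 3).Adelic) => ((rightTranslation (quasiSplit (↥(maximalRealSubfield L)) L (IsCMField.complexConj L) 3)).comp ((standardMaximalCompactGL 3 L).comap (adelicVal (↥(maximalRealSubfield L)) L (IsCMField.complexConj L) 3 ((StdForm.antidiagonal 3).over L)) :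
      Subgroup (quasiSplit (↥(maximalRealSubfield L)) L (IsCMField.complexConj L) 3).Adelic).subtype) k φ))}).topologicalClosure) :
    ∀ (L : Type) [Field L] [NumberField L] [IsCMField L]
      (μ : Measure (quasiSplit (↥(maximalRealSubfield L)) L (IsCMField.complexConj L) 3).automorphicQuotient) [(quasiSplit (↥(maximalRealSubfield L)) L (IsCMField.complexConj L) 3).IsAutomorphicMeasure μ]
      (μω : HeckeCharacter L) (_ : μω.IsUnitary) (ξ : OneDimAutRepH L), ∀ (E : Submodule ℂ (resGMidBlock L μ ξ μω).toSubmodule)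
          (hE : ∀ k, ∀ x ∈ E, ((resGMidBlock L μ ξ μω).toContRep.restrict (((standardMaximalCompactGL 3 L).comap (adelicVal (↥(maximalRealSubfield L)) L (IsCMField.complexConj L) 3 ((StdForm.antidiagonal 3).over L)) : Subgroup (quasiSplit (↥(maximalRealSubfield L)) L (IsCMField.complexConj L) 3).Adelic)).subtype) k x ∈ E), FiniteDimensional ℂ E →
          (((resGMidBlock L μ ξ μω).toContRep.restrict (((standardMaximalCompactGL 3 L).comap (adelicVal (↥(maximalRealSubfield L)) L (IsCMField.complexConj L) 3 ((StdForm.antidiagonal 3).over L)) : Subgroup (quasiSplit (↥(maximalRealSubfield L)) L (IsCMField.complexConj L) 3).Adelic)).subtype).subRep E hE).IsIrreducible →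
          FiniteDimensional ℂ (Representation.homRangeSum ((resGMidBlock L μ ξ μω).toContRep.restrict (((standardMaximalCompactGL 3 L).comap (adelicVal (↥(maximalRealSubfield L)) L (IsCMField.complexConj L) 3 ((StdForm.antidiagonal 3).over L)) : Subgroup (quasiSplit (↥(maximalRealSubfield L)) L (IsCMField.complexConj L) 3).Adelic)).subtype).toRepresentation (((resGMidBlock L μ ξ μω).toContRep.restrict (((standardMaximalCompactGL 3 L).comap (adelicVal (↥(maximalRealSubfield L)) L (IsCMField.complexConj L) 3 ((StdForm.antidiagonal 3).over L)) : Subgroup (quasiSplit (↥(maximalRealSubfield L)) L (IsCMField.complexConj L) 3).Adelic)).subtype).subRep E hE)) :=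
  hDISC_of_inv_of_admissible hINV (hADM_of_W1 hW1)

end Corollaries

end Summit.HodgeConjecture.HodgeConjecture.R90.S8

end
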